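import Literature.NumberTheory.PAdicHodge.AinfRamifiedPSeriesContracting
import Literature.NumberTheory.PAdicHodge.AinfWeierstrassTorsionLift
import Literature.NumberTheory.EllipticCurves.FormalGroupMultiplicationUniversalProofs
import Mathlib.RingTheory.PowerSeries.Expand
import HarnessLib

/-!
# Fontaine's element `[t] ∈ ker θ_𝒪 ⊂ A_inf(𝒪) = 𝔸_inf(F)[ϖ]` of a `p`-power-compatible sequence of torsion points of the
# formal group of a Weierstrass equation over the ramified base `𝒪_D = ℤ_p[ϖ]`

Topic `Literature/NumberTheory/PAdicHodge`; the ramified twin of `AinfWeierstrassTorsionLift` (case `𝒪 = ℤ_p`, `W/ℤ`),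
assembly of `AinfRamifiedFontaineLimit` (Fontaine's limit in `A_inf(𝒪)`), `AinfRamifiedPSeriesContracting`
(`P = p·f + g(X^p)` is contracting on `𝔫_𝒪`), `AinfRamifiedFormalGroupPoints` §6 (the discrete coefficient ring `𝒪_D`) and
`EllipticCurves/FormalGroupMultiplicationUniversalProofs` (Silverman AEC IV.4.4 `[p] = p·f + g(Tᵖ)` over EVERY ring).
For a Weierstrass equation `W` over `𝒪_D = ℤ_p[X]/(f)` (e.g. the good model over `𝒪_{ℚ_p(ϖ)}` of an elliptic curve
with potentially good reduction), a prime `p` and the `p`-adic field `F ∋ ϖ`: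

* `mulP W` — multiplication by `p` on the points `Ŵ(𝔫_𝒪)` with values in `𝔫_𝒪 = θ_𝒪⁻¹(𝔪_{ℂ_F}) ⊂ A_inf(𝒪)`, and
  `mulPC W` — the same on `Ŵ(𝔪_{ℂ_F})` (through `𝒪_D → 𝒪_{ℂ_F}`); `θ_𝒪 ∘ [p] = [p] ∘ θ_𝒪` (`theta_mulP`),
  `σ ∘ [p] = [p] ∘ σ` (`gal_mulP`);
* **`isContracting_mulP`** — `[p]_W` is contracting for the `(p, ω)`-adic filtration;
* for a `p`-power-compatible sequence of torsion points `t : ℕ → Ŵ(𝔪_{ℂ_F})` (`[p] t_{n+1} = t_n`, `t_0 = 0`) and ANY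
  lifts `ûₙ ∈ 𝔫_𝒪`: **`torsionLift W t := lim [pⁿ]_W(ûₙ) ∈ A_inf(𝒪)`** exists (`tendsto_torsionLift`), is independent of
  the lifts (`torsionLift_eq_flim`), lies in `ker θ_𝒪 = ω A_inf(𝒪)` (`theta_torsionLift`), and is `Γ_F`-equivariant
  (`gal_torsionLift : σ[t] = [σ t]`).

Also: `𝒪_D` has no `p`-torsion (`EisensteinRoot.CoeffDisc.eq_zero_of_natCast_mul_eq_zero`), whence `f(0) = 0` in AEC
IV.4.4 over `𝒪_D` (`constantCoeff_formalMulPPart`). Definitions (reviewed): `mulP`, `mulPC`, `lift`, `galLift`,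
`torsionLift`. No named facts, no `sorry`. BSD / K★: infrastructure for the supersingular sector of hDR over a ramified
base; no statement about elliptic curves over number fields is proved here.

## References
* J.-M. Fontaine, *Le corps des périodes p-adiques*, Astérisque 223 (1994), Exp. II §1.2. [FontaineAsterisque223III]
* J. H. Silverman, *The Arithmetic of Elliptic Curves* (2009), IV.4.4, IV.2–IV.3. [SilvermanAEC2009]
* J.-P. Serre, *Local class field theory* (Cassels–Fröhlich Ch. VI) §3.2. [CasselsFrohlichANT1967]
* L. Fargues, J.-M. Fontaine, Astérisque 406 (2018), §2.2. [FarguesFontaine2018]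
-/

noncomputable section

open Ideal Filter Topology Field WittVector MvPowerSeries ValuativeRel

namespace Literature.NumberTheory.PAdicHodge

open Literature.NumberTheory.GaloisRepresentations
open Literature.NumberTheory.GaloisRepresentations.IsNonarchimedeanLocalField
open Literature.NumberTheory.GaloisRepresentations.LubinTate

variable {F : Type} [Field F] [ValuativeRel F] [TopologicalSpace F] [IsNonarchimedeanLocalField F] [CharZero F]
  {p : ℕ} [Fact p.Prime] {hp : valuation F p < 1} {D : EisensteinRoot F p hp}

/-! ## §0 `𝒪_D` has no `p`-torsion; `f(0) = 0` in `[p] = p·f + g(Tᵖ)` over `𝒪_D` -/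

namespace EisensteinRoot

/-- **`𝒪_D = ℤ_p[X]/(f)` has no `p`-torsion** (free over the domain `ℤ_p` on the power basis).
[cite: SerreLocalFields1979, Ch. I §6 Prop. 18] -/
theorem Coeff.eq_zero_of_natCast_mul_eq_zero {c : D.Coeff} (h : (p : D.Coeff) * c = 0) : c = 0 := by
  set hb := (AdjoinRoot.powerBasis' D.monic).basis with hbdef
  have h1 : ((p : ℤ_[p]) • c) = 0 := by rw [Algebra.smul_def, map_natCast]; exact h
  have h2 : ∀ i, hb.repr c i = 0 := fun i => by
    have h3 := congrArg (fun x => hb.repr x i) h1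
    simp only [map_smul, Finsupp.smul_apply, smul_eq_mul, map_zero, Finsupp.zero_apply] at h3
    exact (mul_eq_zero.1 h3).resolve_left (Nat.cast_ne_zero.2 (Fact.out : p.Prime).ne_zero)
  exact (LinearEquiv.map_eq_zero_iff hb.repr).1 (Finsupp.ext h2)

/-- `𝒪_D` has no `p`-torsion (discrete copy). [cite: SerreLocalFields1979, Ch. I §6 Prop. 18] -/
theorem CoeffDisc.eq_zero_of_natCast_mul_eq_zero {c : CoeffDisc D} (h : (p : CoeffDisc D) * c = 0) : c = 0 :=
  Coeff.eq_zero_of_natCast_mul_eq_zero (D := D) (c := (CoeffDisc.of D).symm c) h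

end EisensteinRoot

/-- **`f(0) = 0`** in Silverman's `[p](T) = p·f(T) + g(Tᵖ)` over `𝒪_D` (constant terms: `0 = p·f(0) + g(0) = p·f(0)`,
and `𝒪_D` has no `p`-torsion). [cite: SilvermanAEC2009, IV.4.4] -/
theorem constantCoeff_formalMulPPart (W : WeierstrassCurve (EisensteinRoot.CoeffDisc D)) :
    PowerSeries.constantCoeff (W.formalMulPPart p) = 0 := by
  have h := congrArg PowerSeries.constantCoeff (W.formalMul_prime_eq_add_expand p)
  rw [W.constantCoeff_formalMul, map_add, map_mul, map_natCast, PowerSeries.constantCoeff_expand,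
    W.constantCoeff_formalMulFrobPart, add_zero] at h
  exact EisensteinRoot.CoeffDisc.eq_zero_of_natCast_mul_eq_zero h.symm

namespace AinfRamTop

variable [Fact (¬ IsUnit (p : integerC F))] [IsAdicComplete (Ideal.span {(p : integerC F)}) (integerC F)]
  {hθ : Function.Surjective (fontaineTheta (integerC F) p)} (W : WeierstrassCurve (EisensteinRoot.CoeffDisc D))

/-! ## §1 Multiplication by `p` on `Ŵ(𝔫)` and on `Ŵ(𝔪_{ℂ_F})` -/

/-- **`[p]_W` on `Ŵ(𝔫)`**: evaluation of the integral multiplication-by-`p` series of `W` at points of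
`𝔫 ⊂ 𝔸_inf(F)`. [cite: SilvermanAEC2009, IV.2–IV.3] -/
def mulP (a : (nilTheta D hθ).toIdeal) : (nilTheta D hθ).toIdeal :=
  evalPt₁ (nilTheta D hθ) (W.formalMul p) (W.constantCoeff_formalMul p) a

/-- **`[p]_W` on `Ŵ(𝔪_{ℂ_F})`**. [cite: SilvermanAEC2009, IV.2–IV.3] -/
def mulPC (t : (maxNilIdealC F).toIdeal) : (maxNilIdealC F).toIdeal :=
  evalPt₁ (maxNilIdealC F) (W.formalMul p) (W.constantCoeff_formalMul p) t

/-- **`θ ∘ [p] = [p] ∘ θ`.** [cite: CasselsFrohlichANT1967, Ch. VI §3.2] -/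
theorem theta_mulP (a : (nilTheta D hθ).toIdeal) :
    theta D (mulP W a : AinfRamTop D) = (mulPC W ⟨theta D a, theta_mem_maxNilIdealC a.2⟩ : CBall F) :=
  theta_evalPt (EisensteinRoot.theta_algebraMap_coeffDisc D) _ (W.constantCoeff_formalMul p) (fun _ : Unit => a)
    (fun _ : Unit => ⟨theta D a, theta_mem_maxNilIdealC a.2⟩) fun _ => rfl

/-- **`σ ∘ [p] = [p] ∘ σ`** on `Ŵ(𝔫)`. [cite: FontaineAsterisque223III, Exp. II §1.2] -/
theorem gal_mulP (σ : absoluteGaloisGroup F) (a : (nilTheta D hθ).toIdeal) :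
    gal D σ (mulP W a : AinfRamTop D) = (mulP W ⟨gal D σ a, gal_mem_nilTheta σ a.2⟩ : AinfRamTop D) :=
  gal_evalPt σ (EisensteinRoot.gal_algebraMap_coeffDisc D σ) _ (W.constantCoeff_formalMul p) (fun _ : Unit => a)
    (fun _ : Unit => ⟨gal D σ a, gal_mem_nilTheta σ a.2⟩) fun _ => rfl

/-- **`[p]_W` is contracting on `Ŵ(𝔫)`** (Silverman AEC IV.4.4 over every ring: `[p] = p·f + g(T^p)`, tree `formalMul_prime_eq_add_expand`).
[cite: SilvermanAEC2009, IV.4.4] -/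
theorem isContracting_mulP : IsContracting hθ (mulP (hθ := hθ) W) :=
  isContracting_evalPt₁_of_decomp (W.constantCoeff_formalMul p) (constantCoeff_formalMulPPart W)
    (W.constantCoeff_formalMulFrobPart p) (by rw [← PowerSeries.expand_apply]; exact W.formalMul_prime_eq_add_expand p)

/-- Iterates: `θ ∘ [p]ⁿ = [p]ⁿ ∘ θ`. [cite: CasselsFrohlichANT1967, Ch. VI §3.2] -/
theorem theta_mulP_iterate (n : ℕ) (a : (nilTheta D hθ).toIdeal) :
    theta D (((mulP W)^[n] a : (nilTheta D hθ).toIdeal) : AinfRamTop D) =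
      (((mulPC W)^[n] ⟨theta D a, theta_mem_maxNilIdealC a.2⟩ : (maxNilIdealC F).toIdeal) : CBall F) := by
  induction n generalizing a with
  | zero => rfl
  | succ n ih =>
    rw [Function.iterate_succ_apply, Function.iterate_succ_apply, ih]
    congr 2
    exact Subtype.ext (theta_mulP W a)

/-! ## §2 `p`-power-compatible sequences of torsion points and their lifts -/

omit [Fact (¬ IsUnit (p : integerC F))] [IsAdicComplete (Ideal.span {(p : integerC F)}) (integerC F)] in
/-- `[p]ᵏ t_{m+k} = t_m` for a `[p]`-compatible sequence. [cite: SilvermanAEC2009, IV.3] -/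
theorem mulPC_iterate_eq {t : ℕ → (maxNilIdealC F).toIdeal} (htp : ∀ n, mulPC W (t (n + 1)) = t n) (m : ℕ) :
    ∀ k : ℕ, (mulPC W)^[k] (t (m + k)) = t m
  | 0 => rfl
  | k + 1 => by
    rw [Function.iterate_succ_apply, ← Nat.add_assoc, htp, mulPC_iterate_eq htp m k]

/-- Lifts of a `[p]`-compatible sequence satisfy `[p] û_{n+1} ≡ ûₙ (mod (p, ω))`. [cite: FontaineAsterisque223III, Exp. II §1.2.2] -/
theorem mulP_lift_sub_mem {t : ℕ → (maxNilIdealC F).toIdeal} (htp : ∀ n, mulPC W (t (n + 1)) = t n)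
    {u : ℕ → (nilTheta D hθ).toIdeal} (hu : ∀ n, theta D (u n : AinfRamTop D) = t n) (n : ℕ) :
    ((mulP W (u (n + 1)) : (nilTheta D hθ).toIdeal) : AinfRamTop D) - u n ∈ (WithIdeal.i : Ideal (AinfRamTop D)) := by
  refine sub_mem_ideal_of_theta_eq ?_
  rw [theta_mulP, hu n]
  have h : (⟨theta D (u (n + 1) : AinfRamTop D), theta_mem_maxNilIdealC (u (n + 1)).2⟩ : (maxNilIdealC F).toIdeal) =
      t (n + 1) := Subtype.ext (hu (n + 1))
  rw [h, htp]

/-- `θ([pⁿ] ûₙ) = [pⁿ] tₙ = t₀ = 0`. [cite: FontaineAsterisque223III, Exp. II §1.2.2] -/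
theorem theta_approx_eq_zero {t : ℕ → (maxNilIdealC F).toIdeal} (ht0 : (t 0 : CBall F) = 0)
    (htp : ∀ n, mulPC W (t (n + 1)) = t n)
    {u : ℕ → (nilTheta D hθ).toIdeal} (hu : ∀ n, theta D (u n : AinfRamTop D) = t n) (n : ℕ) :
    theta D (approx (mulP W) u n) = 0 := by
  rw [approx_def, theta_mulP_iterate]
  have h : (⟨theta D (u n : AinfRamTop D), theta_mem_maxNilIdealC (u n).2⟩ : (maxNilIdealC F).toIdeal) = t (0 + n) :=
    Subtype.ext (by rw [zero_add]; exact hu n)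
  rw [h, mulPC_iterate_eq W htp 0 n, ht0]

/-! ## §3 Fontaine's element `[t]` -/

variable (D) in
/-- A choice of lifts `ûₙ ∈ 𝔫_𝒪` of the points `tₙ ∈ 𝔪_{ℂ_F}` (`θ_𝒪` is onto). [cite: FontaineAsterisque223III, Exp. II §1.2.2] -/
def lift (hθ : Function.Surjective (fontaineTheta (integerC F) p)) (t : ℕ → (maxNilIdealC F).toIdeal) (n : ℕ) :
    (nilTheta D hθ).toIdeal :=
  Classical.choose (exists_theta_eq (hθ := hθ) (t n))

/-- The chosen lifts lift. [cite: FontaineAsterisque223III, Exp. II §1.2.2] -/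
theorem theta_lift (t : ℕ → (maxNilIdealC F).toIdeal) (n : ℕ) : theta D (lift D hθ t n : AinfRamTop D) = t n :=
  Classical.choose_spec (exists_theta_eq (hθ := hθ) (t n))

/-- **Fontaine's element `[t] = lim [pⁿ]_W(ûₙ) ∈ 𝔸_inf(F)`** of a `[p]`-compatible sequence `t` of points of
`Ŵ(𝔪_{ℂ_F})` (for the chosen lifts; independent of them by `torsionLift_eq_flim`).
[cite: FontaineAsterisque223III, Exp. II §1.2.2] -/
def torsionLift (hθ : Function.Surjective (fontaineTheta (integerC F) p)) (t : ℕ → (maxNilIdealC F).toIdeal)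
    (htp : ∀ n, mulPC W (t (n + 1)) = t n) : AinfRamTop D :=
  flim (isContracting_mulP (hθ := hθ) W) (lift D hθ t) (mulP_lift_sub_mem W htp (theta_lift t))

/-- **Independence of the lifts**: for ANY lifts `uₙ` of `tₙ`, `lim [pⁿ](uₙ) = [t]`.
[cite: FontaineAsterisque223III, Exp. II §1.2.2] -/
theorem torsionLift_eq_flim {t : ℕ → (maxNilIdealC F).toIdeal} (htp : ∀ n, mulPC W (t (n + 1)) = t n)
    {u : ℕ → (nilTheta D hθ).toIdeal} (hu : ∀ n, theta D (u n : AinfRamTop D) = t n) :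
    torsionLift W hθ t htp = flim (isContracting_mulP (hθ := hθ) W) u (mulP_lift_sub_mem W htp hu) :=
  flim_congr _ _ _ fun n => sub_mem_ideal_of_theta_eq (by rw [theta_lift, hu])

/-- The approximants `[pⁿ](uₙ)` converge to `[t]`, for any lifts. [cite: FontaineAsterisque223III, Exp. II §1.2.2] -/
theorem tendsto_torsionLift {t : ℕ → (maxNilIdealC F).toIdeal} (htp : ∀ n, mulPC W (t (n + 1)) = t n)
    {u : ℕ → (nilTheta D hθ).toIdeal} (hu : ∀ n, theta D (u n : AinfRamTop D) = t n) :
    Tendsto (approx (mulP W) u) atTop (𝓝 (torsionLift W hθ t htp)) := by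
  rw [torsionLift_eq_flim W htp hu]
  exact tendsto_approx_flim _ _

/-- **`θ([t]) = 0`**: Fontaine's element lies in `ker θ_𝒪 = ω A_inf(𝒪)` when `t₀ = 0`.
[cite: FontaineAsterisque223III, Exp. II §1.2.2] -/
theorem theta_torsionLift {t : ℕ → (maxNilIdealC F).toIdeal} (ht0 : (t 0 : CBall F) = 0)
    (htp : ∀ n, mulPC W (t (n + 1)) = t n) : theta D (torsionLift W hθ t htp) = 0 :=
  theta_flim_eq_zero _ _ (theta_approx_eq_zero W ht0 htp (theta_lift t))

variable (D) in
/-- The `σ`-translate of the chosen lifts, as a sequence of points of `𝔫_𝒪`. [cite: FontaineAsterisque223III, Exp. II §1.2] -/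
def galLift (hθ : Function.Surjective (fontaineTheta (integerC F) p)) (σ : absoluteGaloisGroup F)
    (t : ℕ → (maxNilIdealC F).toIdeal) (n : ℕ) : (nilTheta D hθ).toIdeal :=
  ⟨gal D σ (lift D hθ t n), gal_mem_nilTheta σ (lift D hθ t n).2⟩

/-- `θ(σ ûₙ) = σ tₙ`: the translated lifts lift the translated sequence. [cite: FontaineAsterisque223III, Exp. II §1.2] -/
theorem theta_galLift (σ : absoluteGaloisGroup F) (t : ℕ → (maxNilIdealC F).toIdeal) (n : ℕ) :
    theta D (galLift D hθ σ t n : AinfRamTop D) = AinfTop.galSeq F σ t n := by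
  apply Subtype.ext
  change ((theta D (gal D σ (lift D hθ t n : AinfRamTop D)) : CBall F) : CompletedAlgClosure F) = _
  rw [coe_theta_gal, theta_lift, AinfTop.coe_galSeq, coe_galCBall]

/-- `σ` acts on `[p]`-compatible sequences of `Ŵ(𝔪_{ℂ_F})` (`σ ∘ [p] = [p] ∘ σ` on `𝒪_{ℂ_F}`-points, by transport
through `θ` and the lifts). [cite: FontaineAsterisque223III, Exp. II §1.2] -/
theorem mulPC_galSeq (hθ' : Function.Surjective (fontaineTheta (integerC F) p)) (σ : absoluteGaloisGroup F)
    {t : ℕ → (maxNilIdealC F).toIdeal} (htp : ∀ n, mulPC W (t (n + 1)) = t n) (n : ℕ) :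
    mulPC W (AinfTop.galSeq F σ t (n + 1)) = AinfTop.galSeq F σ t n := by
  -- `θ(σ [p] û_{n+1}) = [p](θ(σ û_{n+1})) = [p](σ t_{n+1})` and `θ(σ [p] û_{n+1}) = σ θ([p] û_{n+1}) = σ t_n`
  have h1 : theta D (gal D σ (mulP W (lift D hθ' t (n + 1)) : AinfRamTop D)) =
      (mulPC W (AinfTop.galSeq F σ t (n + 1)) : CBall F) := by
    rw [gal_mulP, theta_mulP]
    congr 2
    exact Subtype.ext (theta_galLift (D := D) (hθ := hθ') σ t (n + 1))
  have h2 : theta D (gal D σ (mulP W (lift D hθ' t (n + 1)) : AinfRamTop D)) = (AinfTop.galSeq F σ t n : CBall F) := by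
    apply Subtype.ext
    rw [coe_theta_gal, theta_mulP, AinfTop.coe_galSeq, coe_galCBall]
    have h : (⟨theta D (lift D hθ' t (n + 1) : AinfRamTop D), theta_mem_maxNilIdealC (lift D hθ' t (n + 1)).2⟩ :
        (maxNilIdealC F).toIdeal) = t (n + 1) := Subtype.ext (theta_lift t (n + 1))
    rw [h, htp]
  exact Subtype.ext (h1.symm.trans h2)

/-- **`Γ_F`-equivariance of Fontaine's element: `σ[t] = [σ t]`.** [cite: FontaineAsterisque223III, Exp. II §1.2] -/
theorem gal_torsionLift (σ : absoluteGaloisGroup F) {t : ℕ → (maxNilIdealC F).toIdeal}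
    (htp : ∀ n, mulPC W (t (n + 1)) = t n) :
    gal D σ (torsionLift W hθ t htp) = torsionLift W hθ (AinfTop.galSeq F σ t) (mulPC_galSeq W hθ σ htp) := by
  have hsu : ∀ n, ((mulP W (galLift D hθ σ t (n + 1)) : (nilTheta D hθ).toIdeal) : AinfRamTop D) - galLift D hθ σ t n ∈
      (WithIdeal.i : Ideal (AinfRamTop D)) :=
    mulP_lift_sub_mem W (mulPC_galSeq W hθ σ htp) (theta_galLift σ t)
  rw [torsionLift, torsionLift_eq_flim W (mulPC_galSeq W hθ σ htp) (theta_galLift σ t)]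
  exact map_flim (isContracting_mulP (hθ := hθ) W) (continuous_gal σ)
    (fun a => ⟨gal D σ a, gal_mem_nilTheta σ a.2⟩) (fun _ => rfl) (fun a => Subtype.ext (gal_mulP W σ a))
    (u := lift D hθ t) (su := galLift D hθ σ t) (fun _ => rfl) (mulP_lift_sub_mem W htp (theta_lift t)) hsu

end AinfRamTop

end Literature.NumberTheory.PAdicHodge

end
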